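import Literature.Computability.QuantumComplexity.ExactCompilerInstances
import Literature.Computability.QuantumComplexity.PathModelGadgetDefect
import Literature.Computability.QuantumComplexity.PlaceGateNorm
import HarnessLib

/-!
# Encoded primitives: braid words for compiled one-qubit gates and gadget phases

Topic `Literature/Computability/QuantumComplexity`. Proof infrastructure for the
`PromiseBQP`-hardness of the Jones polynomial at `k = 5` (Aharonov–Arad 2011, Thm. 3.1, §3):
the link between the exact compiler (`ExactCompiler*`, words over the four-letter alphabet
`Letter` evaluated in `SU(2)`) and the path-model operators on the `4n`-strand register
(`PathModelEncoded*`, `PathModelGadget*`):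

* `braidOp l` — the path-model operator of a list of crossings in OPERATOR order
  (`= ajlBraidMatrix 5 l`, `ajlBraidMatrix_eq`), a contraction;
* ONE-QUBIT: `letterGens₁ a γ` / `wordGens₁ a w` — the crossings of block `a` realising a letter /
  a word of the one-qubit instance `E₁`, the exact intertwining
  `braidOp (wordGens₁ a w) · encIso = encIso · placeGate (wireEmb a) (unre (ev w))`
  (`braidOp_wordGens₁_mul_encIso`) and the **defect bound** by the compilation error
  (`defect_wordGens₁_le`);
* GADGET: `symsOfWord w` — the gadget symbols (time order) of a word of the gadget instance `E₂`,
  `piOp`, `piVec_symsOfWord` (the bookkeeping vector is the first column of the word's matrix),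
  `gadgetGens a ha g` (`braidOp_gadgetGens = Gadget.bigOp`), and the **defect bound**
  `defect_gadgetGens_le`: `≤ 6 ‖T - π̃(ev w)‖` for a diagonal target `T = diag(u, v)`.

## References

* D. Aharonov, I. Arad, New J. Phys. 13 (2011) 035019, §3.1–§3.3, Claim 3.1 [AharonovArad2011].
-/

noncomputable section

open scoped Matrix.Norms.L2Operator

namespace Literature.Computability.QuantumComplexity

open Matrix Cryptography Complex ExactCompiler

variable {n : ℕ}

/-! ### Path-model operators of crossing lists -/

/-- A crossing of the `4n`-strand braid group (generator index, sign). [cite: AharonovArad2011, §3.1] -/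
abbrev Gen (n : ℕ) : Type := Fin (n * 4 - 1) × Bool

/-- **The path-model operator of a list of crossings**, in operator order. [cite: AharonovArad2011, §3.1] -/
def braidOp (l : List (Gen n)) : Matrix (QReg (n * 4)) (QReg (n * 4)) ℂ := (l.map (ajlCrossingMatrix 5)).prod

/-- `braidOp [] = 1`. [folklore] -/
@[simp] theorem braidOp_nil : braidOp ([] : List (Gen n)) = 1 := by simp [braidOp]

/-- `braidOp (g :: l) = ρ(g) · braidOp l`. [folklore] -/
@[simp] theorem braidOp_cons (g : Gen n) (l : List (Gen n)) : braidOp (g :: l) = ajlCrossingMatrix 5 g * braidOp l := by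
  simp [braidOp]

/-- `braidOp (l ++ l') = braidOp l · braidOp l'`. [folklore] -/
theorem braidOp_append (l l' : List (Gen n)) : braidOp (l ++ l') = braidOp l * braidOp l' := by
  simp [braidOp, List.prod_append]

/-- `braidOp` is the library's braid-word matrix. [cite: AharonovJonesLandau2009, Cor. 3.1] -/
theorem ajlBraidMatrix_eq_braidOp (l : List (Gen n)) : ajlBraidMatrix 5 l = braidOp l := ajlBraidMatrix_eq 5 l

/-- `braidOp l` is a contraction. [cite: AharonovJonesLandau2009, Cor. 3.1] -/
theorem norm_braidOp_le_one (l : List (Gen n)) : ‖braidOp l‖ ≤ 1 := by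
  rw [← ajlBraidMatrix_eq_braidOp]; exact norm_ajlBraidMatrix_le_one 5 l

/-! ### One-qubit words on a block -/

/-- Back from `Fin 2` to `QReg 1` indexing. [folklore] -/
def unre (P : Matrix (Fin 2) (Fin 2) ℂ) : Matrix (QReg 1) (QReg 1) ℂ := Matrix.reindex qRegOneEquiv.symm qRegOneEquiv.symm P

/-- `unre` is multiplicative. [folklore] -/
theorem unre_mul (P Q : Matrix (Fin 2) (Fin 2) ℂ) : unre (P * Q) = unre P * unre Q := by
  unfold unre; rw [Matrix.reindex_apply, Matrix.reindex_apply, Matrix.reindex_apply, Matrix.submatrix_mul_equiv]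

/-- `unre` is additive-linear: differences. [folklore] -/
theorem unre_sub (P Q : Matrix (Fin 2) (Fin 2) ℂ) : unre (P - Q) = unre P - unre Q := by
  ext i j; simp [unre]

/-- `unre` preserves the norm. [folklore] -/
theorem norm_unre (P : Matrix (Fin 2) (Fin 2) ℂ) : ‖unre P‖ = ‖P‖ := l2_opNorm_reindex _ _ P

/-- `unre (blockCrossing2 r ε) = blockCrossing r ε`. [folklore] -/
theorem unre_blockCrossing2 (r : Fin 3) (ε : Bool) : unre (blockCrossing2 r ε) = blockCrossing r ε := by
  unfold unre blockCrossing2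
  rw [← Matrix.reindex_symm, Equiv.symm_apply_apply]

/-- **The crossings of block `a` realising a letter** of the one-qubit instance (operator order):
`x = σ_{4a+1} σ_{4a+2}⁻¹`, `y = σ_{4a+1}⁻¹ σ_{4a+2}`, and their inverses. [cite: AharonovArad2011, §4] -/
def letterGens₁ (a : Fin n) : Letter → List (Gen n)
  | Letter.x => [(blockGen a 0, true), (blockGen a 1, false)]
  | Letter.y => [(blockGen a 0, false), (blockGen a 1, true)]
  | Letter.xi => [(blockGen a 1, true), (blockGen a 0, false)]
  | Letter.yi => [(blockGen a 1, false), (blockGen a 0, true)]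

/-- The crossings of a word (operator order). [cite: AharonovArad2011, §3.3] -/
def wordGens₁ (a : Fin n) (w : List Letter) : List (Gen n) := w.flatMap (letterGens₁ a)

/-- `X⁻¹ = ρ(σ₂) ρ(σ₁)⁻¹` over `K5`. [cite: AharonovArad2011, §4] -/
theorem adjK_X1K : K5.adjK X1K = G1K true * G0K false := by decide +kernel

/-- `Y⁻¹ = ρ(σ₂)⁻¹ ρ(σ₁)` over `K5`. [cite: AharonovArad2011, §4] -/
theorem adjK_Y1K : K5.adjK Y1K = G1K false * G0K true := by decide +kernel

/-- The product of two block crossings through `unre`. [folklore] -/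
theorem blockCrossing_mul_eq_unre (r r' : Fin 3) (ε ε' : Bool) (P Q : Matrix (Fin 2) (Fin 2) K5)
    (hP : P.map K5.toComplex = blockCrossing2 r ε) (hQ : Q.map K5.toComplex = blockCrossing2 r' ε') :
    blockCrossing r ε * blockCrossing r' ε' = unre ((P * Q).map K5.toComplex) := by
  rw [K5.map_mulK, hP, hQ, unre_mul, unre_blockCrossing2, unre_blockCrossing2]

/-- **Exact intertwining of a letter**: `braidOp (letterGens₁ a γ) · encIso = encIso · (mat₁ γ on wire a)`.
[cite: AharonovArad2011, §3.1 and §4] -/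
theorem braidOp_letterGens₁_mul_encIso (a : Fin n) (γ : Letter) :
    braidOp (letterGens₁ a γ) * encIso n = encIso n * placeGate (wireEmb a) (unre ((mat₁ γ).map K5.toComplex)) := by
  have key : ∀ (r r' : Fin 3) (ε ε' : Bool),
      braidOp [((blockGen a r, ε) : Gen n), (blockGen a r', ε')] * encIso n =
        encIso n * placeGate (wireEmb a) (blockCrossing r ε * blockCrossing r' ε') := by
    intro r r' ε ε'
    rw [braidOp_cons, braidOp_cons, braidOp_nil, Matrix.mul_one, Matrix.mul_assoc, ajlCrossingMatrix_blockGen_mul_encIso,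
      ← Matrix.mul_assoc, ajlCrossingMatrix_blockGen_mul_encIso, Matrix.mul_assoc, ← placeGate_mul_holds]
  cases γ
  · rw [letterGens₁, key, mat₁, X1K, blockCrossing_mul_eq_unre 0 1 true false _ _ (map_G0K true) (map_G1K false)]
  · rw [letterGens₁, key, mat₁, Y1K, blockCrossing_mul_eq_unre 0 1 false true _ _ (map_G0K false) (map_G1K true)]
  · rw [letterGens₁, key, mat₁, adjK_X1K, blockCrossing_mul_eq_unre 1 0 true false _ _ (map_G1K true) (map_G0K false)]
  · rw [letterGens₁, key, mat₁, adjK_Y1K, blockCrossing_mul_eq_unre 1 0 false true _ _ (map_G1K false) (map_G0K true)]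

/-- **Exact intertwining of a word.** [cite: AharonovArad2011, §3.1 and §3.3] -/
theorem braidOp_wordGens₁_mul_encIso (a : Fin n) : ∀ w : List Letter,
    braidOp (wordGens₁ a w) * encIso n = encIso n * placeGate (wireEmb a) (unre ((w.map mat₁).prod.map K5.toComplex))
  | [] => by
    simp only [wordGens₁, List.flatMap_nil, braidOp_nil, Matrix.one_mul, List.map_nil, List.prod_nil,
      Matrix.map_one K5.toComplex (map_zero _) (map_one _)]
    rw [show unre 1 = 1 by unfold unre; simp, placeGate_one, Matrix.mul_one]
  | γ :: w => by
    have ih := braidOp_wordGens₁_mul_encIso a w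
    rw [wordGens₁, List.flatMap_cons, braidOp_append, Matrix.mul_assoc, ← wordGens₁, ih, ← Matrix.mul_assoc,
      braidOp_letterGens₁_mul_encIso, Matrix.mul_assoc, ← placeGate_mul_holds, ← unre_mul, ← K5.map_mulK, List.map_cons,
      List.prod_cons]

/-- **Defect of a compiled one-qubit word**: against the target `T` placed on wire `a`, the defect
is at most the compilation error `‖T - ev w‖`. [cite: AharonovArad2011, §3.3, Claim 3.1] -/
theorem defect_wordGens₁_le (a : Fin n) (w : List Letter) (T : Matrix (Fin 2) (Fin 2) ℂ) :
    ‖braidOp (wordGens₁ a w) * encIso n - encIso n * placeGate (wireEmb a) (unre T)‖ ≤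
      ‖T - (w.map mat₁).prod.map K5.toComplex‖ := by
  rw [braidOp_wordGens₁_mul_encIso, ← Matrix.mul_sub]
  calc ‖encIso n * (placeGate (wireEmb a) (unre ((w.map mat₁).prod.map K5.toComplex)) - placeGate (wireEmb a) (unre T))‖
      ≤ ‖encIso n‖ * ‖placeGate (wireEmb a) (unre ((w.map mat₁).prod.map K5.toComplex)) - placeGate (wireEmb a) (unre T)‖ :=
        Matrix.l2_opNorm_mul _ _
    _ ≤ 1 * ‖unre ((w.map mat₁).prod.map K5.toComplex) - unre T‖ :=
        mul_le_mul (norm_le_one_of_isometry conjTranspose_encIso_mul_encIso) (norm_placeGate_sub_placeGate_le _ _ _)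
          (norm_nonneg _) zero_le_one
    _ = ‖T - (w.map mat₁).prod.map K5.toComplex‖ := by rw [one_mul, ← unre_sub, norm_unre, norm_sub_rev]

/-! ### Gadget words on a window -/

/-- **The gadget symbols of a letter** of the gadget instance, in TIME order:
`x = π(M'⁻¹)π(M)` is the time word `M, M'⁻¹`, etc. [cite: AharonovArad2011, §4] -/
def symsOf : Letter → List Gadget.Sym
  | Letter.x => [Gadget.Sym.M, Gadget.Sym.M'inv]
  | Letter.xi => [Gadget.Sym.M', Gadget.Sym.Minv]
  | Letter.y => [Gadget.Sym.Minv, Gadget.Sym.M']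
  | Letter.yi => [Gadget.Sym.M'inv, Gadget.Sym.M]

/-- The gadget symbols of a word (operator order in, time order out). [cite: AharonovArad2011, §3.3] -/
def symsOfWord (w : List Letter) : List Gadget.Sym := (w.reverse.map symsOf).flatten

/-- The operator of a time-ordered symbol list on the encoded pair. [cite: AharonovArad2011, §3.2] -/
def piOp (g : List Gadget.Sym) : Matrix (Fin 2) (Fin 2) K5 := (g.reverse.map Gadget.piMat).prod

/-- `piOp (g ++ g') = piOp g' · piOp g`. [folklore] -/
theorem piOp_append (g g' : List Gadget.Sym) : piOp (g ++ g') = piOp g' * piOp g := by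
  simp [piOp, List.reverse_append, List.prod_append]

/-- `piOp (s :: g) = piOp g · π(s)`. [folklore] -/
theorem piOp_cons (s : Gadget.Sym) (g : List Gadget.Sym) : piOp (s :: g) = piOp g * Gadget.piMat s := by
  simp [piOp, List.prod_append]

/-- `piOp` of a letter's symbols is the letter's matrix. [cite: AharonovArad2011, §4] -/
theorem piOp_symsOf (γ : Letter) : piOp (symsOf γ) = mat₂ γ := by
  cases γ <;> simp [piOp, symsOf, mat₂, Gadget.X2K, Gadget.Y2K, Gadget.X2invK, Gadget.Y2invK]

/-- **`piOp (symsOfWord w)` is the word's matrix.** [cite: AharonovArad2011, §3.3] -/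
theorem piOp_symsOfWord : ∀ w : List Letter, piOp (symsOfWord w) = (w.map mat₂).prod
  | [] => by simp [symsOfWord, piOp]
  | γ :: w => by
    have ih := piOp_symsOfWord w
    rw [symsOfWord, List.reverse_cons, List.map_append, List.flatten_append, piOp_append, ← symsOfWord, ih,
      List.map_singleton, List.flatten_singleton, piOp_symsOf, List.map_cons, List.prod_cons]

/-- The action on bookkeeping vectors. [folklore] -/
def act (P : Matrix (Fin 2) (Fin 2) K5) (v : K5 × K5) : K5 × K5 := (P 0 0 * v.1 + P 0 1 * v.2, P 1 0 * v.1 + P 1 1 * v.2)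

/-- A symbol steps by the action of its matrix. [cite: AharonovArad2011, §3.2] -/
theorem step_eq_act (s : Gadget.Sym) (v : K5 × K5) : s.step v = act (Gadget.piMat s) v := by
  simp [Gadget.Sym.step, act, Gadget.piMat]

/-- The action is multiplicative. [folklore] -/
theorem act_mul (P Q : Matrix (Fin 2) (Fin 2) K5) (v : K5 × K5) : act (P * Q) v = act P (act Q v) := by
  simp only [act, Matrix.mul_apply, Fin.sum_univ_two, Prod.mk.injEq]
  constructor <;> ring

/-- The bookkeeping vector with an arbitrary start. [folklore] -/
theorem foldl_step_eq (g : List Gadget.Sym) : ∀ v : K5 × K5, g.foldl (fun pq s => s.step pq) v = act (piOp g) v := by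
  induction g with
  | nil => intro v; simp [piOp, act]
  | cons s g ih =>
    intro v
    rw [List.foldl_cons, ih, piOp_cons, act_mul, step_eq_act]

/-- **The bookkeeping vector of a word is the first column of its matrix.** [cite: AharonovArad2011, §3.2] -/
theorem piVec_symsOfWord (w : List Letter) :
    Gadget.piVec (symsOfWord w) = (((w.map mat₂).prod) 0 0, ((w.map mat₂).prod) 1 0) := by
  rw [Gadget.piVec, foldl_step_eq, piOp_symsOfWord]
  simp [act]

/-- **The crossings of the gadget word on the window at block `a`** (operator order). [cite: AharonovArad2011, §3.2] -/
def gadgetGens (a : ℕ) (ha : a + 2 ≤ n) (g : List Gadget.Sym) : List (Gen n) :=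
  ((Gadget.expand g).reverse.map Gadget.toWin).map fun l => (windowGen a l.1.1 (windowGen_lt ha l.1.2), l.2)

/-- `braidOp (gadgetGens a ha g) = Gadget.bigOp a ha g`. [cite: AharonovArad2011, §3.2] -/
theorem braidOp_gadgetGens (a : ℕ) (ha : a + 2 ≤ n) (g : List Gadget.Sym) : braidOp (gadgetGens a ha g) = Gadget.bigOp a ha g := by
  unfold braidOp gadgetGens Gadget.bigOp
  rw [List.map_map]
  rfl

/-- `√ν ≥ 9/10` (`ν = 3φ - 4 ≥ 0.81`). [folklore] -/
theorem sqrtNu_ge : (9 / 10 : ℝ) ≤ Gadget.sqrtNu := by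
  unfold Gadget.sqrtNu
  rw [show (9 / 10 : ℝ) = Real.sqrt ((9 / 10) ^ 2) by rw [Real.sqrt_sq]; norm_num]
  apply Real.sqrt_le_sqrt
  rw [ZPhi.toReal_apply]
  change ((9 : ℝ) / 10) ^ 2 ≤ ((-4 : ℤ) : ℝ) + ((3 : ℤ) : ℝ) * Real.goldenRatio
  push_cast
  have : (1.61 : ℝ) < Real.goldenRatio := by
    rw [Real.goldenRatio]
    have h : (2.22 : ℝ) < Real.sqrt 5 := by rw [Real.lt_sqrt (by norm_num)]; norm_num
    linarith
  nlinarith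

/-- The `(1,0)` entry of the unitarisation is `√ν` times the entry. [cite: AharonovArad2011, §3.2] -/
theorem tildeOf_apply_one_zero (A : Matrix (Fin 2) (Fin 2) K5) : Gadget.tildeOf A 1 0 = Gadget.sqrtNu * K5.toComplex (A 1 0) := by
  unfold Gadget.tildeOf Gadget.dMat Gadget.dInv
  simp only [Matrix.mul_apply, Fin.sum_univ_two, Matrix.map_apply, Matrix.of_apply, Matrix.cons_val', Matrix.cons_val_zero,
    Matrix.cons_val_one, Matrix.empty_val', Matrix.cons_val_fin_one]
  ring

/-- **Defect of a compiled gadget word**: against the controlled phase `u` on blocks `a, a+1`, with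
a diagonal target `T = diag(u, v)`, the defect is at most `6 ‖T - π̃(ev w)‖`.
[cite: AharonovArad2011, §3.2–§3.3, Claim 3.1] -/
theorem defect_gadgetGens_le (a : ℕ) (ha : a + 2 ≤ n) (w : List Letter) (u v : ℂ) :
    ‖braidOp (gadgetGens a ha (symsOfWord w)) * encIso n - encIso n * Gadget.ctrlPhase a ha u‖ ≤
      6 * ‖!![u, 0; 0, v] - Gadget.tildeOf ((w.map mat₂).prod)‖ := by
  set P := (w.map mat₂).prod with hP
  set ε := ‖!![u, 0; 0, v] - Gadget.tildeOf P‖ with hε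
  rw [braidOp_gadgetGens]
  refine le_trans (Gadget.norm_bigOp_mul_encIso_sub_le a ha (symsOfWord w) u) ?_
  rw [piVec_symsOfWord]
  have h1 : ‖K5.toComplex (P 0 0) - u‖ ≤ ε := by
    have e : K5.toComplex (P 0 0) - u = -((!![u, 0; 0, v] - Gadget.tildeOf P) 0 0) := by
      rw [Matrix.sub_apply, tildeOf_apply_zero_zero]; simp
    rw [e, norm_neg]; exact norm_apply_le_l2_opNorm _ 0 0
  have h2 : ‖K5.toComplex (P 1 0)‖ ≤ (10 / 9) * ε := by
    have e : (Gadget.sqrtNu : ℂ) * K5.toComplex (P 1 0) = -((!![u, 0; 0, v] - Gadget.tildeOf P) 1 0) := by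
      rw [Matrix.sub_apply, tildeOf_apply_one_zero]; simp
    have hn : ‖(Gadget.sqrtNu : ℂ) * K5.toComplex (P 1 0)‖ ≤ ε := by rw [e, norm_neg]; exact norm_apply_le_l2_opNorm _ 1 0
    rw [norm_mul, Complex.norm_real, Real.norm_of_nonneg Gadget.sqrtNu_pos.le] at hn
    have hs := sqrtNu_ge
    have hε0 : 0 ≤ ε := norm_nonneg _
    have : Gadget.sqrtNu * ‖K5.toComplex (P 1 0)‖ * (10 / 9) ≤ ε * (10 / 9) := by nlinarith
    nlinarith [norm_nonneg (K5.toComplex (P 1 0))]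
  change ‖K5.toComplex (P 0 0) - u‖ + 4 * ‖K5.toComplex (P 1 0)‖ ≤ 6 * ε
  nlinarith [norm_nonneg (K5.toComplex (P 1 0))]

end Literature.Computability.QuantumComplexity

end
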